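import Mathlib
import HarnessLib
import Summits.ValiantsHypothesis.ValiantsHypothesis.Theorems.LacunarySymmetroidMatrixDescartesProductPlusOneSlopePhases

/-!
# LINE (A) `product_plus_one` — the two MONOTONE windows (any number of humps): the LATE window and the all-switched EARLY window
# carry at most ONE zero of the company's log-Wronskian, at most TWO of `eulerNumerator d a l₀` for every coupling (LINE currency, K = 3)

Crux item stmt-ValiantsHypothesis-18050, W-budget frame EB2-W (`WronskianBudgetK3`, owner memo §14/§19; eng-11 W-COLUMN §5 «c₀ + K(I)»).
Built on ✓/⧗ `…ProductPlusOneSlopePhases` (`riser_mode_persist`, `riser_premode_persist`) and ✓ `…SlopeLine` (`logWronskian_prod_eq_rowPsi1_sum`).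
`P = ∏_j fewnomial d (a j)`, `W(P) = P·θ²P − (θP)²`, support `d 1 = d 0 + e₁ + 1`, `d 2 = d 1 + e₂ + 1`, window `[u,v] ⊂ (0,∞)`;
`ψ₁_j, ψ₂_j` = `rowPsi1/rowPsi2 e₁ e₂ (a j 0) (−a j 1) (−a j 2)` (normal form of ✓ `…CloudDefs`; the row's slope is `−ψ₁_j`).

* ★ `lateWindow_wronskian_roots_le_one` — every row EITHER a switched incoherent riser PAST ITS SLOPE-MODE at `u` (`a_{j0} ≥ 0 > a_{j1}, a_{j2}`,
  `f_j < 0` on `[u,v]`, `ψ₁_j(u) < 0 ≤ ψ₂_j(u)`) OR an unswitched incoherent puller (`a_{j0} > 0`, `a_{j1}, a_{j2} ≤ 0`, `a_{j1}+a_{j2} < 0`, `f_j(v) > 0`)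
  ⇒ `Σ_j ψ₁_j` is strictly increasing on `[u,v]` ⇒ `W(P)` has AT MOST ONE root in `(u,v)` — ANY NUMBER of humps: beyond the last slope-mode a pole-free
  window is wiggle-free (the «old humps act as one decreasing mass» half of the per-window constant c₀);
  `lateWindow_eulerNumerator_roots_le_two` — hence ≤ 2 roots of `eulerNumerator d a l₀` on `[u,v]` for EVERY coupling (✓ interlace).
* `earlyWindow_wronskian_roots_le_one` / `earlyWindow_eulerNumerator_roots_le_two` — the mirror: every row a switched incoherent riser BEFORE its
  slope-mode at `v` (`ψ₂_j(v) ≤ 0`; e.g. the stretch of the right outer window up to the first mode) ⇒ `Σ_j ψ₁_j` strictly decreasing ⇒ ≤ 1 / ≤ 2.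

Located context (this seat's numerics, bus 05:02Z): two risers + cloud carries ≤ 4 zeros per window and the feature-free window (young row in its
negative phase + old humps + pullers) ≤ 2, both 0 violations under adversarial search — NOT proved here (no sign/convexity mechanism; magnitude law).
HONEST FRAMING: two monotone cells; nothing here proves `WronskianBudgetK3` / `OneChangeFloorK3` / the stubs / 18050 / `MatrixDescartes`;
`VP ≠ VNP` is NOT proved.  No definitions, no named facts.
-/

set_option linter.dupNamespace false

namespace Summit.ValiantsHypothesis.ValiantsHypothesis.Theorems.LacunarySymmetroidMatrixDescartes

namespace ProductPlusOne

open Finset Polynomial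
open scoped BigOperators Polynomial

/-- ★ **LATE WINDOW — any number of old humps against an incoherent cloud: AT MOST ONE zero of `W(∏ f_j)`** (LINE currency, K = 3).
Support `d 1 = d 0 + e₁ + 1`, `d 2 = d 1 + e₂ + 1`; window `[u,v] ⊂ (0,∞)`.  Every row is EITHER a switched incoherent riser
(`a_{j0} ≥ 0`, `a_{j1} < 0`, `a_{j2} < 0`, `f_j < 0` on `[u,v]`) past its slope-mode at `u` (`ψ₁_j(u) < 0`, `ψ₂_j(u) ≥ 0`, normal form of
✓ `…CloudDefs` with `(A,B,C) = (a_{j0}, −a_{j1}, −a_{j2})`) OR an unswitched incoherent puller (`a_{j0} > 0`, `a_{j1} ≤ 0`, `a_{j2} ≤ 0`,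
`a_{j1} + a_{j2} < 0`, `f_j(v) > 0`).  Then `#{roots of W(P) in (u,v)} ≤ 1`. [this file's theorem] -/
theorem lateWindow_wronskian_roots_le_one {m : ℕ} (d : Fin 3 → ℕ) (e₁ e₂ : ℕ)
    (he₁ : d 1 = d 0 + e₁ + 1) (he₂ : d 2 = d 1 + e₂ + 1) (a : Fin m → Fin 3 → ℝ) {u v : ℝ} (hu : 0 < u)
    (hcls : ∀ j,
      (0 ≤ a j 0 ∧ a j 1 < 0 ∧ a j 2 < 0 ∧ (∀ x ∈ Set.Icc u v, (∑ l, C (a j l) * X ^ (d l) : ℝ[X]).eval x < 0) ∧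
          rowPsi1 e₁ e₂ (a j 0) (-(a j 1)) (-(a j 2)) u < 0 ∧ 0 ≤ rowPsi2 e₁ e₂ (a j 0) (-(a j 1)) (-(a j 2)) u) ∨
      (0 < a j 0 ∧ a j 1 ≤ 0 ∧ a j 2 ≤ 0 ∧ a j 1 + a j 2 < 0 ∧ 0 < (∑ l, C (a j l) * X ^ (d l) : ℝ[X]).eval v)) :
    (((∏ j, ∑ l, C (a j l) * X ^ (d l) : ℝ[X]) * (X * derivative (X * derivative (∏ j, ∑ l, C (a j l) * X ^ (d l) : ℝ[X])))
        - (X * derivative (∏ j, ∑ l, C (a j l) * X ^ (d l) : ℝ[X])) ^ 2).roots.toFinset.filter (fun w => u < w ∧ w < v)).card ≤ 1 := by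
  classical
  set W : ℝ[X] := (∏ j, ∑ l, C (a j l) * X ^ (d l) : ℝ[X]) * (X * derivative (X * derivative (∏ j, ∑ l, C (a j l) * X ^ (d l) : ℝ[X])))
      - (X * derivative (∏ j, ∑ l, C (a j l) * X ^ (d l) : ℝ[X])) ^ 2 with hWdef
  by_contra hgt
  push Not at hgt
  obtain ⟨y₁, hy₁, y₂, hy₂, h12'⟩ := exists_two_lt_of_card (T := W.roots.toFinset.filter (fun w => u < w ∧ w < v)) hgt
  by_cases hW0 : W = 0
  · rw [hW0, roots_zero, Multiset.toFinset_zero, Finset.filter_empty] at hy₁; exact absurd hy₁ (Finset.notMem_empty _)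
  rw [mem_filter, Multiset.mem_toFinset, mem_roots hW0] at hy₁ hy₂
  have hd := fin3_support_eq_gaps d e₁ e₂ he₁ he₂
  have hev : ∀ j x, (∑ l, C (a j l) * X ^ (d l) : ℝ[X]).eval x
        = x ^ (d 0) * (a j 0 - (-(a j 1)) * x ^ (e₁ + 1) - (-(a j 2)) * x ^ (e₁ + e₂ + 2)) := by
    intro j x
    have h := (eval_trinomial_three (d 0) (e₁ + 1) (e₁ + e₂ + 2) (a j) x).1
    rw [hd] at h; rw [h]; ring
  have hv : u < v := hy₁.2.1.trans hy₁.2.2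
  have hx0 : ∀ x ∈ Set.Icc u v, 0 < x := fun x hx => hu.trans_le hx.1
  -- normal-form signs of every row on the window
  have hrow : ∀ x ∈ Set.Icc u v, ∀ j,
      (0 ≤ a j 0 ∧ 0 < -(a j 1) ∧ 0 < -(a j 2) ∧ a j 0 - (-(a j 1)) * x ^ (e₁ + 1) - (-(a j 2)) * x ^ (e₁ + e₂ + 2) < 0) ∨
      (0 ≤ -(a j 1) ∧ 0 ≤ -(a j 2) ∧ 0 < -(a j 1) + -(a j 2) ∧ 0 < a j 0 - (-(a j 1)) * x ^ (e₁ + 1) - (-(a j 2)) * x ^ (e₁ + e₂ + 2)) := by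
    intro x hx j
    have hx' := hx0 x hx
    rcases hcls j with ⟨h0, h1, h2, hsw, _, _⟩ | ⟨_, h1, h2, h12, hun⟩
    · left
      have h := hsw x hx
      rw [hev] at h
      exact ⟨h0, by linarith, by linarith,
        ((mul_neg_iff.1 h).resolve_right (fun h' => absurd (pow_pos hx' _) (not_lt.2 h'.1.le))).2⟩
    · right
      rw [hev] at hun
      have hv0 : 0 < v := hu.trans hv
      have h3 : 0 < a j 0 - (-(a j 1)) * v ^ (e₁ + 1) - (-(a j 2)) * v ^ (e₁ + e₂ + 2) :=
        (mul_pos_iff_of_pos_left (pow_pos hv0 _)).1 hun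
      have hm1 : a j 1 * v ^ (e₁ + 1) ≤ a j 1 * x ^ (e₁ + 1) := mul_le_mul_of_nonpos_left (pow_le_pow_left₀ hx'.le hx.2 _) h1
      have hm2 : a j 2 * v ^ (e₁ + e₂ + 2) ≤ a j 2 * x ^ (e₁ + e₂ + 2) := mul_le_mul_of_nonpos_left (pow_le_pow_left₀ hx'.le hx.2 _) h2
      exact ⟨by linarith, by linarith, by linarith, by linarith⟩
  have hFne : ∀ x ∈ Set.Icc u v, ∀ j, a j 0 - (-(a j 1)) * x ^ (e₁ + 1) - (-(a j 2)) * x ^ (e₁ + e₂ + 2) ≠ 0 := by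
    intro x hx j
    rcases hrow x hx j with ⟨_, _, _, h⟩ | ⟨_, _, _, h⟩
    · exact h.ne
    · exact h.ne'
  have hf : ∀ x ∈ Set.Icc u v, ∀ j, (∑ l, C (a j l) * X ^ (d l) : ℝ[X]).eval x ≠ 0 := by
    intro x hx j
    rw [hev]; exact mul_ne_zero (pow_ne_zero _ (hx0 x hx).ne') (hFne x hx j)
  -- the switched rows are switched in normal form on the whole window
  have hswn : ∀ j, (∀ x ∈ Set.Icc u v, (∑ l, C (a j l) * X ^ (d l) : ℝ[X]).eval x < 0) →
      ∀ t ∈ Set.Icc u v, a j 0 - (-(a j 1)) * t ^ (e₁ + 1) - (-(a j 2)) * t ^ (e₁ + e₂ + 2) < 0 := by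
    intro j hsw t ht
    have h := hsw t ht
    rw [hev] at h
    exact ((mul_neg_iff.1 h).resolve_right (fun h' => absurd (pow_pos (hx0 t ht) _) (not_lt.2 h'.1.le))).2
  -- the slope-form sum `G = Σ_j ψ₁_j` and its derivative `Σ_j ψ₂_j / x`
  set G : ℝ → ℝ := fun t => ∑ j, rowPsi1 e₁ e₂ (a j 0) (-(a j 1)) (-(a j 2)) t with hG
  have hGder : ∀ x ∈ Set.Icc u v,
      HasDerivAt G ((∑ j, rowPsi2 e₁ e₂ (a j 0) (-(a j 1)) (-(a j 2)) x) / x) x := by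
    intro x hx
    have h := HasDerivAt.fun_sum (u := Finset.univ) fun j _ =>
      hasDerivAt_rowPsi1 e₁ e₂ (a j 0) (-(a j 1)) (-(a j 2)) (hx0 x hx).ne' (hFne x hx j)
    refine (h.congr_of_eventuallyEq (Filter.Eventually.of_forall fun t => ?_)).congr_deriv ?_
    · simp only [hG]
    · rw [Finset.sum_div]
  -- every `ψ₂_j ≥ 0` strictly inside the window
  have hψ2 : ∀ x ∈ Set.Ioc u v, ∀ j, 0 ≤ rowPsi2 e₁ e₂ (a j 0) (-(a j 1)) (-(a j 2)) x := by
    intro x hx j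
    have hxI : x ∈ Set.Icc u v := ⟨hx.1.le, hx.2⟩
    rcases hcls j with ⟨h0, h1, h2, hsw, hpost, hmode⟩ | _
    · exact (riser_mode_persist e₁ e₂ (a j 0) (-(a j 1)) (-(a j 2)) h0 (by linarith) (by linarith) hu hv.le (hswn j hsw)
        hpost hmode x hx).le
    · rcases hrow x hxI j with ⟨_, hb, hc, hF⟩ | ⟨hb, hc, hbc, hF⟩
      · -- a switched riser certified only by signs: `ψ₂ ≥ 0` is not needed, but this branch cannot be a puller; use the other disjunct
        rcases hcls j with ⟨h0, h1, h2, hsw, hpost, hmode⟩ | ⟨_, h1, h2, _, hun⟩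
        · exact (riser_mode_persist e₁ e₂ (a j 0) (-(a j 1)) (-(a j 2)) h0 (by linarith) (by linarith) hu hv.le (hswn j hsw)
            hpost hmode x hx).le
        · exfalso
          rw [hev] at hun
          have hv0 : 0 < v := hu.trans hv
          have h3 : 0 < a j 0 - (-(a j 1)) * v ^ (e₁ + 1) - (-(a j 2)) * v ^ (e₁ + e₂ + 2) :=
            (mul_pos_iff_of_pos_left (pow_pos hv0 _)).1 hun
          have hx' := hx0 x hxI
          have hm1 : a j 1 * v ^ (e₁ + 1) ≤ a j 1 * x ^ (e₁ + 1) := mul_le_mul_of_nonpos_left (pow_le_pow_left₀ hx'.le hxI.2 _) h1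
          have hm2 : a j 2 * v ^ (e₁ + e₂ + 2) ≤ a j 2 * x ^ (e₁ + e₂ + 2) := mul_le_mul_of_nonpos_left (pow_le_pow_left₀ hx'.le hxI.2 _) h2
          linarith
      · exact (rowPsi_signs e₁ e₂ (a j 0) (-(a j 1)) (-(a j 2)) (hx0 x hxI) hb hc hbc hF).2.2
  -- case split: is there an old riser at all?
  by_cases hold : ∃ j, 0 ≤ a j 0 ∧ a j 1 < 0 ∧ a j 2 < 0 ∧ (∀ x ∈ Set.Icc u v, (∑ l, C (a j l) * X ^ (d l) : ℝ[X]).eval x < 0) ∧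
      rowPsi1 e₁ e₂ (a j 0) (-(a j 1)) (-(a j 2)) u < 0 ∧ 0 ≤ rowPsi2 e₁ e₂ (a j 0) (-(a j 1)) (-(a j 2)) u
  · obtain ⟨j₀, h0, h1, h2, hsw, hpost, hmode⟩ := hold
    have hstrict : ∀ x ∈ Set.Ioc u v, 0 < ∑ j, rowPsi2 e₁ e₂ (a j 0) (-(a j 1)) (-(a j 2)) x := by
      intro x hx
      have hj₀ := riser_mode_persist e₁ e₂ (a j₀ 0) (-(a j₀ 1)) (-(a j₀ 2)) h0 (by linarith) (by linarith) hu hv.le (hswn j₀ hsw)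
        hpost hmode x hx
      exact Finset.sum_pos' (fun j _ => hψ2 x hx j) ⟨j₀, Finset.mem_univ _, hj₀⟩
    -- `G` strictly increasing on `[u,v]`
    have hcont : ContinuousOn G (Set.Icc u v) := fun x hx => (hGder x hx).continuousAt.continuousWithinAt
    have hmono : StrictMonoOn G (Set.Icc u v) := by
      refine strictMonoOn_of_deriv_pos (convex_Icc u v) hcont fun x hx => ?_
      rw [interior_Icc] at hx
      rw [(hGder x ⟨hx.1.le, hx.2.le⟩).deriv]
      exact div_pos (hstrict x ⟨hx.1, hx.2.le⟩) (hx0 x ⟨hx.1.le, hx.2.le⟩)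
    -- but `G` vanishes at `y₁ < y₂`
    have hGz : ∀ y, W.eval y = 0 → y ∈ Set.Icc u v → G y = 0 := by
      intro y hy hyI
      have h := hy
      rw [hWdef, logWronskian_prod_eq_rowPsi1_sum d e₁ e₂ he₁ he₂ a (hx0 y hyI) (hf y hyI)] at h
      have hP : ((∏ j, (∑ l, C (a j l) * X ^ (d l) : ℝ[X])).eval y) ≠ 0 := by
        rw [eval_prod]; exact Finset.prod_ne_zero_iff.2 fun j _ => hf y hyI j
      rcases mul_eq_zero.1 h with h1 | h1
      · exact absurd (neg_eq_zero.1 h1) (pow_ne_zero 2 hP)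
      · simpa only [hG] using h1
    have hI1 : y₁ ∈ Set.Icc u v := ⟨hy₁.2.1.le, hy₁.2.2.le⟩
    have hI2 : y₂ ∈ Set.Icc u v := ⟨hy₂.2.1.le, hy₂.2.2.le⟩
    have hlt := hmono hI1 hI2 h12'
    rw [hGz y₁ hy₁.1 hI1, hGz y₂ hy₂.1 hI2] at hlt
    exact lt_irrefl _ hlt
  · -- all rows are pullers: `W < 0` at `y₁`
    push Not at hold
    have hI1 : y₁ ∈ Set.Icc u v := ⟨hy₁.2.1.le, hy₁.2.2.le⟩
    have hpul : ∀ j, 0 ≤ -(a j 1) ∧ 0 ≤ -(a j 2) ∧ 0 < -(a j 1) + -(a j 2) ∧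
        0 < a j 0 - (-(a j 1)) * y₁ ^ (e₁ + 1) - (-(a j 2)) * y₁ ^ (e₁ + e₂ + 2) := by
      intro j
      rcases hcls j with ⟨h0, h1, h2, hsw, hpost, hmode⟩ | hp
      · exact absurd hmode (not_le.2 (hold j h0 h1 h2 hsw hpost))
      · rcases hrow y₁ hI1 j with ⟨_, _, _, h⟩ | h
        · exfalso
          obtain ⟨_, h1, h2, _, hun⟩ := hp
          rw [hev] at hun
          have hv0 : 0 < v := hu.trans hv
          have h3 : 0 < a j 0 - (-(a j 1)) * v ^ (e₁ + 1) - (-(a j 2)) * v ^ (e₁ + e₂ + 2) :=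
            (mul_pos_iff_of_pos_left (pow_pos hv0 _)).1 hun
          have hx' := hx0 y₁ hI1
          have hm1 : a j 1 * v ^ (e₁ + 1) ≤ a j 1 * y₁ ^ (e₁ + 1) := mul_le_mul_of_nonpos_left (pow_le_pow_left₀ hx'.le hI1.2 _) h1
          have hm2 : a j 2 * v ^ (e₁ + e₂ + 2) ≤ a j 2 * y₁ ^ (e₁ + e₂ + 2) := mul_le_mul_of_nonpos_left (pow_le_pow_left₀ hx'.le hI1.2 _) h2
          linarith
        · exact h
    rcases isEmpty_or_nonempty (Fin m) with hm | hm
    · -- no rows: `W = 0`, excluded above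
      apply hW0
      rw [hWdef]
      simp [Finset.univ_eq_empty]
    · obtain ⟨j₀⟩ := hm
      have hneg := logWronskian_prod_neg_of_slopes_nonneg d e₁ e₂ he₁ he₂ a (hx0 y₁ hI1) (hf y₁ hI1)
        (fun j => (rowPsi_signs e₁ e₂ (a j 0) (-(a j 1)) (-(a j 2)) (hx0 y₁ hI1) (hpul j).1 (hpul j).2.1 (hpul j).2.2.1
          (hpul j).2.2.2).2.1.le)
        ⟨j₀, (rowPsi_signs e₁ e₂ (a j₀ 0) (-(a j₀ 1)) (-(a j₀ 2)) (hx0 y₁ hI1) (hpul j₀).1 (hpul j₀).2.1 (hpul j₀).2.2.1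
          (hpul j₀).2.2.2).2.1⟩
      rw [← hWdef] at hneg
      exact hneg.ne hy₁.1

/-- ★ **LATE WINDOW, Euler currency:** under the same hypotheses (`u ≤ v`), `eulerNumerator d a l₀` has at most TWO roots on `[u,v]`, for EVERY
coupling `l₀` (✓ `eulerNumerator_roots_Icc_le_wronskian_roots_add_one`). [this file's theorem] -/
theorem lateWindow_eulerNumerator_roots_le_two {m : ℕ} (d : Fin 3 → ℕ) (e₁ e₂ : ℕ)
    (he₁ : d 1 = d 0 + e₁ + 1) (he₂ : d 2 = d 1 + e₂ + 1) (a : Fin m → Fin 3 → ℝ) (l₀ : Fin 3) {u v : ℝ} (hu : 0 < u) (huv : u ≤ v)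
    (hcls : ∀ j,
      (0 ≤ a j 0 ∧ a j 1 < 0 ∧ a j 2 < 0 ∧ (∀ x ∈ Set.Icc u v, (∑ l, C (a j l) * X ^ (d l) : ℝ[X]).eval x < 0) ∧
          rowPsi1 e₁ e₂ (a j 0) (-(a j 1)) (-(a j 2)) u < 0 ∧ 0 ≤ rowPsi2 e₁ e₂ (a j 0) (-(a j 1)) (-(a j 2)) u) ∨
      (0 < a j 0 ∧ a j 1 ≤ 0 ∧ a j 2 ≤ 0 ∧ a j 1 + a j 2 < 0 ∧ 0 < (∑ l, C (a j l) * X ^ (d l) : ℝ[X]).eval v)) :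
    ((∑ j, (∑ l, C (a j l * ((d l : ℝ) - d l₀)) * X ^ (d l)) * ∏ i ∈ Finset.univ.erase j, (∑ l, C (a i l) * X ^ (d l))
        : ℝ[X]).roots.toFinset.filter (fun t => u ≤ t ∧ t ≤ v)).card ≤ 2 := by
  classical
  have hd := fin3_support_eq_gaps d e₁ e₂ he₁ he₂
  have hev : ∀ j x, (∑ l, C (a j l) * X ^ (d l) : ℝ[X]).eval x
        = x ^ (d 0) * (a j 0 - (-(a j 1)) * x ^ (e₁ + 1) - (-(a j 2)) * x ^ (e₁ + e₂ + 2)) := by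
    intro j x
    have h := (eval_trinomial_three (d 0) (e₁ + 1) (e₁ + e₂ + 2) (a j) x).1
    rw [hd] at h; rw [h]; ring
  have hP : ∀ t ∈ Set.Icc u v, (∏ j, (∑ l, C (a j l) * X ^ (d l) : ℝ[X])).eval t ≠ 0 := by
    intro t ht
    have ht0 : 0 < t := hu.trans_le ht.1
    rw [eval_prod]
    refine Finset.prod_ne_zero_iff.2 fun j _ => ?_
    rcases hcls j with ⟨_, _, _, hsw, _, _⟩ | ⟨_, h1, h2, _, hun⟩
    · exact (hsw t ht).ne
    · rw [hev] at hun ⊢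
      have hv0 : 0 < v := hu.trans_le huv
      have h3 : 0 < a j 0 - (-(a j 1)) * v ^ (e₁ + 1) - (-(a j 2)) * v ^ (e₁ + e₂ + 2) :=
        (mul_pos_iff_of_pos_left (pow_pos hv0 _)).1 hun
      have hm1 : a j 1 * v ^ (e₁ + 1) ≤ a j 1 * t ^ (e₁ + 1) := mul_le_mul_of_nonpos_left (pow_le_pow_left₀ ht0.le ht.2 _) h1
      have hm2 : a j 2 * v ^ (e₁ + e₂ + 2) ≤ a j 2 * t ^ (e₁ + e₂ + 2) := mul_le_mul_of_nonpos_left (pow_le_pow_left₀ ht0.le ht.2 _) h2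
      exact mul_ne_zero (pow_ne_zero _ ht0.ne') (by linarith)
  have h1 := eulerNumerator_roots_Icc_le_wronskian_roots_add_one d a l₀ hu hP
  have h2 := lateWindow_wronskian_roots_le_one d e₁ e₂ he₁ he₂ a hu hcls
  omega

/-- ★ **EARLY ALL-SWITCHED WINDOW — every row a switched incoherent riser before its slope-mode: AT MOST ONE zero of `W(∏ f_j)`.**
Every row has `a_{j0} ≥ 0`, `a_{j1} < 0`, `a_{j2} < 0`, is switched on `[u,v] ⊂ (0,∞)` and satisfies `ψ₂_j(v) ≤ 0` (slope still increasing at `v`,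
e.g. `v` before the first slope-mode of the right outer window).  Then `Σ_j ψ₁_j` is strictly decreasing and `#{roots of W(P) in (u,v)} ≤ 1`. [this file's theorem] -/
theorem earlyWindow_wronskian_roots_le_one {m : ℕ} (d : Fin 3 → ℕ) (e₁ e₂ : ℕ)
    (he₁ : d 1 = d 0 + e₁ + 1) (he₂ : d 2 = d 1 + e₂ + 1) (a : Fin m → Fin 3 → ℝ) {u v : ℝ} (hu : 0 < u)
    (hcls : ∀ j, 0 ≤ a j 0 ∧ a j 1 < 0 ∧ a j 2 < 0 ∧ (∀ x ∈ Set.Icc u v, (∑ l, C (a j l) * X ^ (d l) : ℝ[X]).eval x < 0) ∧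
      rowPsi2 e₁ e₂ (a j 0) (-(a j 1)) (-(a j 2)) v ≤ 0) :
    (((∏ j, ∑ l, C (a j l) * X ^ (d l) : ℝ[X]) * (X * derivative (X * derivative (∏ j, ∑ l, C (a j l) * X ^ (d l) : ℝ[X])))
        - (X * derivative (∏ j, ∑ l, C (a j l) * X ^ (d l) : ℝ[X])) ^ 2).roots.toFinset.filter (fun w => u < w ∧ w < v)).card ≤ 1 := by
  classical
  set W : ℝ[X] := (∏ j, ∑ l, C (a j l) * X ^ (d l) : ℝ[X]) * (X * derivative (X * derivative (∏ j, ∑ l, C (a j l) * X ^ (d l) : ℝ[X])))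
      - (X * derivative (∏ j, ∑ l, C (a j l) * X ^ (d l) : ℝ[X])) ^ 2 with hWdef
  by_contra hgt
  push Not at hgt
  obtain ⟨y₁, hy₁, y₂, hy₂, h12'⟩ := exists_two_lt_of_card (T := W.roots.toFinset.filter (fun w => u < w ∧ w < v)) hgt
  by_cases hW0 : W = 0
  · rw [hW0, roots_zero, Multiset.toFinset_zero, Finset.filter_empty] at hy₁; exact absurd hy₁ (Finset.notMem_empty _)
  rw [mem_filter, Multiset.mem_toFinset, mem_roots hW0] at hy₁ hy₂
  have hd := fin3_support_eq_gaps d e₁ e₂ he₁ he₂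
  have hev : ∀ j x, (∑ l, C (a j l) * X ^ (d l) : ℝ[X]).eval x
        = x ^ (d 0) * (a j 0 - (-(a j 1)) * x ^ (e₁ + 1) - (-(a j 2)) * x ^ (e₁ + e₂ + 2)) := by
    intro j x
    have h := (eval_trinomial_three (d 0) (e₁ + 1) (e₁ + e₂ + 2) (a j) x).1
    rw [hd] at h; rw [h]; ring
  have hv : u < v := hy₁.2.1.trans hy₁.2.2
  have hx0 : ∀ x ∈ Set.Icc u v, 0 < x := fun x hx => hu.trans_le hx.1
  have hsw' : ∀ x ∈ Set.Icc u v, ∀ j, a j 0 - (-(a j 1)) * x ^ (e₁ + 1) - (-(a j 2)) * x ^ (e₁ + e₂ + 2) < 0 := by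
    intro x hx j
    have h := (hcls j).2.2.2.1 x hx
    rw [hev] at h
    exact ((mul_neg_iff.1 h).resolve_right (fun h' => absurd (pow_pos (hx0 x hx) _) (not_lt.2 h'.1.le))).2
  have hf : ∀ x ∈ Set.Icc u v, ∀ j, (∑ l, C (a j l) * X ^ (d l) : ℝ[X]).eval x ≠ 0 :=
    fun x hx j => ((hcls j).2.2.2.1 x hx).ne
  set G : ℝ → ℝ := fun t => ∑ j, rowPsi1 e₁ e₂ (a j 0) (-(a j 1)) (-(a j 2)) t with hG
  have hGder : ∀ x ∈ Set.Icc u v,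
      HasDerivAt G ((∑ j, rowPsi2 e₁ e₂ (a j 0) (-(a j 1)) (-(a j 2)) x) / x) x := by
    intro x hx
    have h := HasDerivAt.fun_sum (u := Finset.univ) fun j _ =>
      hasDerivAt_rowPsi1 e₁ e₂ (a j 0) (-(a j 1)) (-(a j 2)) (hx0 x hx).ne' (hsw' x hx j).ne
    refine (h.congr_of_eventuallyEq (Filter.Eventually.of_forall fun t => ?_)).congr_deriv ?_
    · simp only [hG]
    · rw [Finset.sum_div]
  have hψ2 : ∀ x ∈ Set.Ico u v, ∀ j, rowPsi2 e₁ e₂ (a j 0) (-(a j 1)) (-(a j 2)) x < 0 := by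
    intro x hx j
    obtain ⟨h0, h1, h2, _, hmode⟩ := hcls j
    exact riser_premode_persist e₁ e₂ (a j 0) (-(a j 1)) (-(a j 2)) h0 (by linarith) (by linarith) hu
      (fun t ht => hsw' t ht j) hmode x hx
  rcases isEmpty_or_nonempty (Fin m) with hm | hm
  · apply hW0
    rw [hWdef]
    simp [Finset.univ_eq_empty]
  obtain ⟨j₀⟩ := hm
  have hstrict : ∀ x ∈ Set.Ico u v, ∑ j, rowPsi2 e₁ e₂ (a j 0) (-(a j 1)) (-(a j 2)) x < 0 := by
    intro x hx
    calc ∑ j, rowPsi2 e₁ e₂ (a j 0) (-(a j 1)) (-(a j 2)) x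
        < ∑ _j : Fin m, (0 : ℝ) := Finset.sum_lt_sum_of_nonempty ⟨j₀, Finset.mem_univ _⟩ (fun j _ => hψ2 x hx j)
      _ = 0 := by simp
  have hcont : ContinuousOn G (Set.Icc u v) := fun x hx => (hGder x hx).continuousAt.continuousWithinAt
  have hanti : StrictAntiOn G (Set.Icc u v) := by
    refine strictAntiOn_of_deriv_neg (convex_Icc u v) hcont fun x hx => ?_
    rw [interior_Icc] at hx
    rw [(hGder x ⟨hx.1.le, hx.2.le⟩).deriv]
    exact div_neg_of_neg_of_pos (hstrict x ⟨hx.1.le, hx.2⟩) (hx0 x ⟨hx.1.le, hx.2.le⟩)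
  have hGz : ∀ y, W.eval y = 0 → y ∈ Set.Icc u v → G y = 0 := by
    intro y hy hyI
    have h := hy
    rw [hWdef, logWronskian_prod_eq_rowPsi1_sum d e₁ e₂ he₁ he₂ a (hx0 y hyI) (hf y hyI)] at h
    have hP : ((∏ j, (∑ l, C (a j l) * X ^ (d l) : ℝ[X])).eval y) ≠ 0 := by
      rw [eval_prod]; exact Finset.prod_ne_zero_iff.2 fun j _ => hf y hyI j
    rcases mul_eq_zero.1 h with h1 | h1
    · exact absurd (neg_eq_zero.1 h1) (pow_ne_zero 2 hP)
    · simpa only [hG] using h1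
  have hI1 : y₁ ∈ Set.Icc u v := ⟨hy₁.2.1.le, hy₁.2.2.le⟩
  have hI2 : y₂ ∈ Set.Icc u v := ⟨hy₂.2.1.le, hy₂.2.2.le⟩
  have hlt := hanti hI1 hI2 h12'
  rw [hGz y₁ hy₁.1 hI1, hGz y₂ hy₂.1 hI2] at hlt
  exact lt_irrefl _ hlt

/-- ★ **EARLY ALL-SWITCHED WINDOW, Euler currency:** `≤ 2` roots of `eulerNumerator d a l₀` on `[u,v]` for EVERY coupling `l₀`. [this file's theorem] -/
theorem earlyWindow_eulerNumerator_roots_le_two {m : ℕ} (d : Fin 3 → ℕ) (e₁ e₂ : ℕ)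
    (he₁ : d 1 = d 0 + e₁ + 1) (he₂ : d 2 = d 1 + e₂ + 1) (a : Fin m → Fin 3 → ℝ) (l₀ : Fin 3) {u v : ℝ} (hu : 0 < u)
    (hcls : ∀ j, 0 ≤ a j 0 ∧ a j 1 < 0 ∧ a j 2 < 0 ∧ (∀ x ∈ Set.Icc u v, (∑ l, C (a j l) * X ^ (d l) : ℝ[X]).eval x < 0) ∧
      rowPsi2 e₁ e₂ (a j 0) (-(a j 1)) (-(a j 2)) v ≤ 0) :
    ((∑ j, (∑ l, C (a j l * ((d l : ℝ) - d l₀)) * X ^ (d l)) * ∏ i ∈ Finset.univ.erase j, (∑ l, C (a i l) * X ^ (d l))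
        : ℝ[X]).roots.toFinset.filter (fun t => u ≤ t ∧ t ≤ v)).card ≤ 2 := by
  classical
  have hP : ∀ t ∈ Set.Icc u v, (∏ j, (∑ l, C (a j l) * X ^ (d l) : ℝ[X])).eval t ≠ 0 := by
    intro t ht
    rw [eval_prod]
    exact Finset.prod_ne_zero_iff.2 fun j _ => ((hcls j).2.2.2.1 t ht).ne
  have h1 := eulerNumerator_roots_Icc_le_wronskian_roots_add_one d a l₀ hu hP
  have h2 := earlyWindow_wronskian_roots_le_one d e₁ e₂ he₁ he₂ a hu hcls
  omega

end ProductPlusOne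

end Summit.ValiantsHypothesis.ValiantsHypothesis.Theorems.LacunarySymmetroidMatrixDescartes
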